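import Literature.FieldTheory.AlgClosed.EmbeddingIntoComplex
import Literature.FieldTheory.AlgClosed.PadicComplexEquivComplex
import Literature.FieldTheory.AlgClosed.AutomorphismExtension   -- ★ `exists_ringEquiv_apply_eq` (§3, ED. 2)
import Mathlib.NumberTheory.NumberField.Completion.FinitePlace
import Mathlib.FieldTheory.IsAlgClosed.AlgebraicClosure
import Mathlib.RingTheory.Algebraic.Cardinality
import HarnessLib

/-!
# `F̄_w` embeds into `ℂ`: the algebraic closure of the completion of a number field at a finite place has
# cardinality at most the continuum, hence admits a ring embedding into `ℂ`

Topic `Literature/FieldTheory/AlgClosed`; namespace `Literature.FieldTheory.AlgClosed`.  THEOREMS ONLY (no definition, no named fact,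
no instance, no notation, no `sorry`).  Cell `hodgecm-mathlib` (D-0151), FLOOR 0, P6 «MOD programme» (crux hLiu418 = stmt-HodgeConjecture-24832,
`--supports`): organ **(S-H-E) «`F̄_w` EMBEDS INTO `ℂ`»** of the GEN lane (A-p18 (g30), 2026-09-01).  The use: the moduli datum reads its
points over `Ω = F̄_w := AlgebraicClosure (w.adicCompletion F)` and lifts special points over the valuation ring `R ⊆ Ω`
(★ `AbelianSchemeFibreAlongIntegralPoint`); the Betti road to socket (S-H) (★ `AbelianSchemeRingActionBlockHeightComplexPoint`:
`hrank_specialFibre_of_complexPoint`) wants ONE ring homomorphism from that base into `ℂ`.  Here: `Ω →+* ℂ` exists (abstractly — Steinitz),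
because `#Ω ≤ 𝔠` (★ `EmbeddingIntoComplex.nonempty_ringHom_complex_of_cardinalMk_le_continuum`).

* §1 **`cardinalMk_adicCompletion_le_continuum`** (`#F_w ≤ 𝔠`: `F` is countable and dense in the
  metric space `F_w` — Mathlib `HeightOneSpectrum.denseRange_algebraMap` and the normed-field structure of `F_w`, ★ `cardinalMk_le_of_denseRange`),
  **`cardinalMk_algebraicClosure_adicCompletion_le_continuum`** (`#F̄_w ≤ 𝔠`), `charZero_algebraicClosure_adicCompletion`.
* §2 HEADS **`nonempty_ringHom_adicCompletion_complex`** (`F_w →+* ℂ`), `nonempty_ringHom_complex_of_isAlgebraic_adicCompletion` (any algebraic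
  `Ω ∕ F_w`) and **`nonempty_ringHom_algebraicClosure_adicCompletion_complex`** (`F̄_w →+* ℂ`).
No compatibility with a given `F →+* ℂ` is asserted in §2 (the (S-H) transport needs none).
* §3 (ED. 2, A-p18 (g31), E-line of `stub_RGD`) **`exists_ringHom_algebraicClosure_adicCompletion_complex_comp_eq`**: `F̄_w →+* ℂ` EXTENDING a
  prescribed `ι₁ : F →+* ℂ` (embeddings of the countable `F` into `ℂ` are conjugate under `Aut(ℂ)` — ★ `exists_ringEquiv_apply_eq`); the frame
  of the PEL chart is a COMPLEX CM type through `ι₁`, read on `F̄_w`-points through such an `ι`.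

HC_CM is proved only modulo the printed citations until rung 0 closes; this file is generic and changes no count.

THE PRINT.  [Robert2000PadicAnalysis] Ch. III §3.5 (Lemma: «`Card(ℂ_p) ≤ Card((ℚ_p^a)^ℕ) = c`» — a complete metric space with a dense subset
`D` has at most `#(ℕ → D)` points) and «`ℂ_p ≃ ℂ` as abstract fields»; [Neukirch1999] Ch. II §4 (the completion `K_v` of a number field at
a finite place, `K` dense in `K_v`); Steinitz' theorem (an algebraically closed field of characteristic `0` and uncountable cardinality `κ`
receives every field of characteristic `0` and cardinality `≤ κ`), as in ★ `EmbeddingIntoComplex`.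

## References
* [Robert2000PadicAnalysis] A. M. Robert, *A Course in p-adic Analysis*, GTM 198 (2000), Ch. III §3.5 (Lemma and its proof).
* [Neukirch1999] J. Neukirch, *Algebraic Number Theory* (1999), Ch. II §4 (completions).
-/

set_option autoImplicit false

noncomputable section

open Cardinal IsDedekindDomain NumberField
open scoped Cardinal

namespace Literature.FieldTheory.AlgClosed

/-! ## §1 `#F_w ≤ 𝔠` and `#F̄_w ≤ 𝔠` -/

/-- **`#F_w ≤ 𝔠`**: the completion of a number field `F` at a finite place `w` has at most continuum many elements (`F` is countable and
dense in the metric space `F_w`, so every element of `F_w` is a limit of a sequence from `F`). [cite: Neukirch1999, Ch. II §4]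
[cite: Robert2000PadicAnalysis, Ch. III §3.5 Lemma (proof)] -/
theorem cardinalMk_adicCompletion_le_continuum (F : Type) [Field F] [NumberField F] (w : HeightOneSpectrum (𝓞 F)) :
    #(w.adicCompletion F) ≤ 𝔠 :=
  (cardinalMk_le_of_denseRange (IsDedekindDomain.HeightOneSpectrum.denseRange_algebraMap (K := F) (v := w))).trans
    (cardinalMk_arrow_nat_le_continuum
      -- `#F ≤ ℵ₀` (a number field is countable: ★ `Barriers.HodgeConjecture.cardinalMk_le_aleph0_of_numberField`; one line here)
      (((Algebra.IsAlgebraic.cardinalMk_le_max ℚ F).trans (max_le Cardinal.mk_le_aleph0 le_rfl)).trans aleph0_le_continuum))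

/-- **`#F̄_w ≤ 𝔠`** (an algebraic extension of `F_w`: `#F̄_w ≤ max #F_w ℵ₀`). [cite: Robert2000PadicAnalysis, Ch. III §3.5 Lemma] -/
theorem cardinalMk_algebraicClosure_adicCompletion_le_continuum (F : Type) [Field F] [NumberField F]
    (w : HeightOneSpectrum (𝓞 F)) : #(AlgebraicClosure (w.adicCompletion F)) ≤ 𝔠 := by
  refine (Algebra.IsAlgebraic.cardinalMk_le_max (w.adicCompletion F) (AlgebraicClosure (w.adicCompletion F))).trans ?_
  exact max_le (cardinalMk_adicCompletion_le_continuum F w) aleph0_le_continuum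

/-- `F̄_w` has characteristic `0` (it contains `F`). [cite: Neukirch1999, Ch. II §4] -/
theorem charZero_algebraicClosure_adicCompletion (F : Type) [Field F] [NumberField F] (w : HeightOneSpectrum (𝓞 F)) :
    CharZero (AlgebraicClosure (w.adicCompletion F)) :=
  charZero_of_injective_algebraMap (algebraMap F (AlgebraicClosure (w.adicCompletion F))).injective

/-! ## §2 The embeddings into `ℂ` -/

/-- **`F_w →+* ℂ` exists** (abstract embedding; Steinitz with `#F_w ≤ 𝔠 = #ℂ`). [cite: Robert2000PadicAnalysis, Ch. III §3.5] -/
theorem nonempty_ringHom_adicCompletion_complex (F : Type) [Field F] [NumberField F] (w : HeightOneSpectrum (𝓞 F)) :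
    Nonempty (w.adicCompletion F →+* ℂ) :=
  haveI : CharZero (w.adicCompletion F) := charZero_of_injective_algebraMap (algebraMap F (w.adicCompletion F)).injective
  nonempty_ringHom_complex_of_cardinalMk_le_continuum _ (cardinalMk_adicCompletion_le_continuum F w)

/-- **Every algebraic extension `Ω` of `F_w` embeds into `ℂ`** (`#Ω ≤ max #F_w ℵ₀ ≤ 𝔠`; in particular every algebraic closure of
`F_w`, however presented). [cite: Robert2000PadicAnalysis, Ch. III §3.5] -/
theorem nonempty_ringHom_complex_of_isAlgebraic_adicCompletion (F : Type) [Field F] [NumberField F] (w : HeightOneSpectrum (𝓞 F))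
    (Ω : Type) [Field Ω] [Algebra (w.adicCompletion F) Ω] [Algebra.IsAlgebraic (w.adicCompletion F) Ω] :
    Nonempty (Ω →+* ℂ) := by
  haveI : CharZero (w.adicCompletion F) := charZero_of_injective_algebraMap (algebraMap F (w.adicCompletion F)).injective
  haveI : CharZero Ω := charZero_of_injective_algebraMap (algebraMap (w.adicCompletion F) Ω).injective
  refine nonempty_ringHom_complex_of_cardinalMk_le_continuum Ω ?_
  refine (Algebra.IsAlgebraic.cardinalMk_le_max (w.adicCompletion F) Ω).trans ?_
  exact max_le (cardinalMk_adicCompletion_le_continuum F w) aleph0_le_continuum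

/-- **`F̄_w →+* ℂ` exists** — the algebraic closure of the completion of a number field at a finite place embeds into `ℂ` (abstractly:
both live in characteristic `0` and `#F̄_w ≤ 𝔠`).  This is the ring homomorphism the Betti road to socket (S-H) asks of the base of the
lifted tuple when that base lies in `F̄_w` (★ `hrank_specialFibre_of_complexPoint`, binder `gℂ`; LEAD M-17w: frame (R-β) of record,
`R := closureValuationSubring ⊆ Ω = F̄_w`). [cite: Robert2000PadicAnalysis, Ch. III §3.5] -/
theorem nonempty_ringHom_algebraicClosure_adicCompletion_complex (F : Type) [Field F] [NumberField F]
    (w : HeightOneSpectrum (𝓞 F)) : Nonempty (AlgebraicClosure (w.adicCompletion F) →+* ℂ) :=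
  nonempty_ringHom_complex_of_isAlgebraic_adicCompletion F w (AlgebraicClosure (w.adicCompletion F))

/-! ## §3 The embedding into `ℂ` extending a prescribed complex embedding of `F` (ED. 2) -/

/-- **`F̄_w →+* ℂ` EXTENDING `ι₁ : F →+* ℂ` exists**: take any `ι₀ : F̄_w →+* ℂ` (§2) and correct it by the automorphism of `ℂ` carrying
`ι₀|_F` to `ι₁` (★ `exists_ringEquiv_apply_eq`: two embeddings of a countable field into an uncountable algebraically closed field are
conjugate).  Use (E-line of `stub_RGD`): the Kottwitz signature of the PEL chart is indexed by COMPLEX embeddings `F →+* ℂ` through `ι₁`;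
at an `F̄_w`-point it is read on the `p`-adic embeddings `τ : F →+* F̄_w` through `ι ∘ τ`, and `ι ∘ (F ⊆ F̄_w) = ι₁` pins the distinguished pair.
[cite: Robert2000PadicAnalysis, Ch. III §3.5] [cite: Lang2002, Ch. V §2 Thm. 2.8] -/
theorem exists_ringHom_algebraicClosure_adicCompletion_complex_comp_eq (F : Type) [Field F] [NumberField F]
    (w : HeightOneSpectrum (𝓞 F)) (ι₁ : F →+* ℂ) :
    ∃ ι : AlgebraicClosure (w.adicCompletion F) →+* ℂ, ι.comp (algebraMap F (AlgebraicClosure (w.adicCompletion F))) = ι₁ := by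
  obtain ⟨ι₀⟩ := nonempty_ringHom_algebraicClosure_adicCompletion_complex F w
  have hℂ : ℵ₀ < #ℂ := by rw [Cardinal.mk_complex]; exact Cardinal.aleph0_lt_continuum
  have hF : #F ≤ ℵ₀ := (Algebra.IsAlgebraic.cardinalMk_le_max ℚ F).trans (max_le Cardinal.mk_le_aleph0 le_rfl)
  obtain ⟨σ, hσ⟩ := exists_ringEquiv_apply_eq hℂ hF (ι₀.comp (algebraMap F (AlgebraicClosure (w.adicCompletion F)))) ι₁
  refine ⟨σ.toRingHom.comp ι₀, ?_⟩
  ext x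
  exact hσ x

end Literature.FieldTheory.AlgClosed
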